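/-
Copyright: rh-split cell (screw, bridge) gen 19, 2026-08-28.  Splitting search over kernel-typed
RH-equivalences.  A splitting `A ∧ B ⟹ RH` is CONDITIONAL bookkeeping unless `A` and `B` are both
proved; nothing here bears on the truth of RH.
-/
import Summits.RiemannHypothesis.RiemannHypothesis.Theorems.Splittings.SlidingTheftGermA
import Summits.RiemannHypothesis.RiemannHypothesis.Theorems.Splittings.PrimeWindowBlindnessClass
import Literature.MathematicalPhysics.QuantumLattice.TorusTestPotential

/-!
# «SLIDING THEFT GERM» — part B of 3: every atom at order t², and (G1) for a configuration

* §9 `cosh_div_sq_re_eq`: `Re[(cosh κt − 1)/κ²] = [(1 − cosh σt cos γt)(γ² − σ²) + 2σγ sinh σt sin γt]/(σ² + γ²)²`;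
  the UNIFORM ATOM FLOOR `Re[…] ≥ −5σ²t²/γ²` (`0 ≤ σ ≤ γ`, `σt ≤ 1`, `t ≥ 0`; the oscillating factor keeps resolved
  at order `t²/γ²`, no case split) hence `quadTerm m κ t ≥ −20 m σ*² t²/γ²` (`quadTerm_ge`); the SIZE bound
  `|quadTerm m κ t| ≤ 12|m|/γ²` (`‖cosh κt‖ ≤ cosh σt ≤ 2`).
* §10 `GermHyp σ* Z` (weights `≥ 0`, abscissae in `[0, σ*]`, `σ* ≤ 1/2`, ordinates `≥ 1`, `Σ m/γ² < ∞`) ⇒ the atom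
  family of `Z.psi t` (tree `Config.psi`, `PrimeWindowBlindnessClass`) is absolutely summable for `0 ≤ t ≤ 1`, and
  **(G1)** `Config.psi_ge_unresolved`: for `0 < t ≤ 1` and ANY finite set `s` of first-family atoms unresolved at `t`
  (`‖κ₁ i‖ t ≤ 1`):  `(43/24) t² Σ_{i∈s} m₁ i − 20 σ*² t² A_Z ≤ Ψ_Z(t)`, `A_Z = Σ' (m₁/γ₁² + m₂/γ₂²)`.

HONEST LABEL: elementary real/complex analysis and finite-sum bookkeeping; an INSTRUMENT for another seat's
conjecture (rh-idea-4 K7 / theory-1 COUNT THEFT LAW); ζ-free, RH-free; toward RH: 0.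
Nothing here bears on the truth of RH.
-/

set_option linter.dupNamespace false

namespace Summit.RiemannHypothesis.RiemannHypothesis.Theorems.Splittings.SlidingGerm

open Summit.RiemannHypothesis.RiemannHypothesis.Theorems.Splittings.ScrewLatticeWolff (quadTerm)

/-! ## 9. Every off-line atom at order `t²`: a uniform lower bound and a uniform size bound -/

/-- Real and imaginary parts of `cosh` at a complex argument: `cosh(κt) = cosh(σt)cos(γt) + i·sinh(σt)sin(γt)`
(`κ = σ + iγ`). -/
theorem cosh_mul_eq (κ : ℂ) (t : ℝ) :
    Complex.cosh (κ * t) = (Real.cosh (κ.re * t) * Real.cos (κ.im * t) : ℝ)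
      + (Real.sinh (κ.re * t) * Real.sin (κ.im * t) : ℝ) * Complex.I := by
  have hk : κ * t = ((κ.re * t : ℝ) : ℂ) + ((κ.im * t : ℝ) : ℂ) * Complex.I := by
    conv_lhs => rw [← Complex.re_add_im κ]
    push_cast
    ring
  rw [hk, Complex.cosh_add, Complex.cosh_mul_I, Complex.sinh_mul_I]
  push_cast
  ring

/-- The atom trace in real coordinates:
`Re[(cosh κt − 1)/κ²] = [(1 − cosh σt·cos γt)(γ² − σ²) + 2σγ·sinh σt·sin γt] / (σ² + γ²)²`. -/
theorem cosh_div_sq_re_eq (κ : ℂ) (t : ℝ) :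
    ((Complex.cosh (κ * t) - 1) / κ ^ 2).re =
      ((1 - Real.cosh (κ.re * t) * Real.cos (κ.im * t)) * (κ.im ^ 2 - κ.re ^ 2)
        + 2 * κ.re * κ.im * (Real.sinh (κ.re * t) * Real.sin (κ.im * t))) / (κ.re ^ 2 + κ.im ^ 2) ^ 2 := by
  rw [Complex.div_re, cosh_mul_eq]
  have hn : Complex.normSq (κ ^ 2) = (κ.re ^ 2 + κ.im ^ 2) ^ 2 := by
    rw [map_pow, Complex.normSq_apply]; ring
  rw [hn]
  simp only [Complex.sub_re, Complex.add_re, Complex.mul_re, Complex.ofReal_re, Complex.ofReal_im,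
    Complex.I_re, Complex.I_im, Complex.one_re, Complex.sub_im, Complex.add_im, Complex.mul_im,
    Complex.one_im, sq]
  ring

/-- `sinh x ≤ 2x` for `0 ≤ x ≤ 1`. -/
theorem sinh_le_two_mul {x : ℝ} (hx0 : 0 ≤ x) (hx : x ≤ 1) : Real.sinh x ≤ 2 * x := by
  have hx' : |x| ≤ 1 := abs_le.mpr ⟨by linarith, hx⟩
  have h1 := (abs_le.mp (Real.abs_exp_sub_one_sub_id_le hx')).2
  have h2 := (abs_le.mp (Real.abs_exp_sub_one_sub_id_le (show |-x| ≤ 1 by rwa [abs_neg]))).1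
  rw [Real.sinh_eq]
  nlinarith

/-- **ATOM LOWER BOUND at order `t²` (uniform in the regime).**  For `κ = σ + iγ` with `0 ≤ σ ≤ γ`, `0 < γ`,
`0 ≤ t`, `σt ≤ 1`:  `Re[(cosh κt − 1)/κ²] ≥ −5σ²t²/γ²`  (first bracket `≥ −(cosh σt − 1)γ² ≥ −σ²t²γ²`, second
`≥ −2σγ·sinh(σt)·|sin γt| ≥ −2σγ·2σt·γt`, denominator `≥ γ⁴`).  The oscillating factor is what keeps the bound
at order `t²/γ²` for RESOLVED atoms; no case split is needed. -/
theorem cosh_div_sq_re_ge {κ : ℂ} {t : ℝ} (hσ0 : 0 ≤ κ.re) (hσγ : κ.re ≤ κ.im) (hγ : 0 < κ.im) (ht : 0 ≤ t)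
    (hσt : κ.re * t ≤ 1) :
    -(5 * κ.re ^ 2 * t ^ 2 / κ.im ^ 2) ≤ ((Complex.cosh (κ * t) - 1) / κ ^ 2).re := by
  rw [cosh_div_sq_re_eq]
  set σ := κ.re with hσ
  set γ := κ.im with hγ'
  have hσt0 : 0 ≤ σ * t := mul_nonneg hσ0 ht
  have hc1 : Real.cosh (σ * t) - 1 ≤ (σ * t) ^ 2 :=
    Literature.MathematicalPhysics.QuantumLattice.cosh_sub_one_le_sq_of_abs_le_one (abs_le.mpr ⟨by linarith, hσt⟩)
  have hc0 : 1 ≤ Real.cosh (σ * t) := Real.one_le_cosh _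
  have hs1 : Real.sinh (σ * t) ≤ 2 * (σ * t) := sinh_le_two_mul hσt0 hσt
  have hs0 : 0 ≤ Real.sinh (σ * t) := Real.sinh_nonneg_iff.mpr hσt0
  have hcos : Real.cos (γ * t) ≤ 1 := Real.cos_le_one _
  have hsin : |Real.sin (γ * t)| ≤ γ * t := by
    simpa [abs_of_nonneg (mul_nonneg hγ.le ht)] using Real.abs_sin_le_abs (x := γ * t)
  -- first bracket
  have hA : -((σ * t) ^ 2 * γ ^ 2) ≤ (1 - Real.cosh (σ * t) * Real.cos (γ * t)) * (γ ^ 2 - σ ^ 2) := by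
    have h1 : -(Real.cosh (σ * t) - 1) ≤ 1 - Real.cosh (σ * t) * Real.cos (γ * t) := by
      nlinarith
    have h2 : 0 ≤ γ ^ 2 - σ ^ 2 := by nlinarith
    have h3 : γ ^ 2 - σ ^ 2 ≤ γ ^ 2 := by nlinarith
    nlinarith [mul_le_mul_of_nonneg_right h1 h2]
  -- second bracket
  have hB : -(4 * σ ^ 2 * γ ^ 2 * t ^ 2) ≤ 2 * σ * γ * (Real.sinh (σ * t) * Real.sin (γ * t)) := by
    have h1 : -(Real.sinh (σ * t) * (γ * t)) ≤ Real.sinh (σ * t) * Real.sin (γ * t) := by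
      have := (abs_le.mp hsin).1
      nlinarith
    have h2 : Real.sinh (σ * t) * (γ * t) ≤ 2 * (σ * t) * (γ * t) := by
      have hγt : 0 ≤ γ * t := mul_nonneg hγ.le ht
      nlinarith
    have hσγ0 : 0 ≤ 2 * σ * γ := by positivity
    nlinarith [mul_le_mul_of_nonneg_left h1 hσγ0]
  have hden : γ ^ 4 ≤ (σ ^ 2 + γ ^ 2) ^ 2 := by nlinarith [sq_nonneg σ, sq_nonneg γ]
  have hden0 : 0 < (σ ^ 2 + γ ^ 2) ^ 2 := by positivity
  have hnum : -(5 * σ ^ 2 * t ^ 2 * γ ^ 2) ≤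
      (1 - Real.cosh (σ * t) * Real.cos (γ * t)) * (γ ^ 2 - σ ^ 2)
        + 2 * σ * γ * (Real.sinh (σ * t) * Real.sin (γ * t)) := by nlinarith
  have key : 5 * σ ^ 2 * t ^ 2 * γ ^ 2 / (σ ^ 2 + γ ^ 2) ^ 2 ≤ 5 * σ ^ 2 * t ^ 2 / γ ^ 2 := by
    rw [div_le_div_iff₀ hden0 (by positivity)]
    have h5 : 0 ≤ 5 * σ ^ 2 * t ^ 2 := by positivity
    nlinarith [mul_le_mul_of_nonneg_left hden h5]
  have k2 : -(5 * σ ^ 2 * t ^ 2 * γ ^ 2) / (σ ^ 2 + γ ^ 2) ^ 2 ≤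
      ((1 - Real.cosh (σ * t) * Real.cos (γ * t)) * (γ ^ 2 - σ ^ 2)
        + 2 * σ * γ * (Real.sinh (σ * t) * Real.sin (γ * t))) / (σ ^ 2 + γ ^ 2) ^ 2 :=
    div_le_div_of_nonneg_right hnum hden0.le
  rw [neg_div] at k2
  linarith

/-- `‖cosh(κt)‖ ≤ cosh(σt)`. -/
theorem norm_cosh_mul_le (κ : ℂ) (t : ℝ) : ‖Complex.cosh (κ * t)‖ ≤ Real.cosh (κ.re * t) := by
  rw [cosh_mul_eq]
  have hc0 : 0 ≤ Real.cosh (κ.re * t) := (Real.cosh_pos _).le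
  refine (sq_le_sq₀ (norm_nonneg _) hc0).mp ?_
  rw [Complex.sq_norm, Complex.normSq_apply]
  simp only [Complex.add_re, Complex.mul_re, Complex.ofReal_re, Complex.ofReal_im, Complex.I_re,
    Complex.I_im, Complex.add_im, Complex.mul_im]
  have h1 := Real.cos_sq_add_sin_sq (κ.im * t)
  have h2 := Real.cosh_sq (κ.re * t)
  nlinarith [sq_nonneg (Real.sinh (κ.re * t)), sq_nonneg (Real.sin (κ.im * t)),
    sq_nonneg (Real.cosh (κ.re * t)), Real.sin_sq_le_one (κ.im * t)]

/-- **ATOM SIZE BOUND.**  For `σt ≤ 1` (`σ = Re κ ≥ 0`, `t ≥ 0`) and `γ = Im κ > 0`: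
`|quadTerm m κ t| ≤ 12·|m|/γ²`  (`‖cosh κt‖ + 1 ≤ cosh σt + 1 ≤ 3`, `‖κ‖² ≥ γ²`). -/
theorem abs_quadTerm_le {m : ℝ} {κ : ℂ} {t : ℝ} (hσ0 : 0 ≤ κ.re) (hγ : 0 < κ.im) (ht : 0 ≤ t)
    (hσt : κ.re * t ≤ 1) : |quadTerm m κ t| ≤ 12 * |m| / κ.im ^ 2 := by
  have hκ : κ ≠ 0 := fun h ↦ by rw [h] at hγ; simp at hγ
  have hnorm : κ.im ^ 2 ≤ ‖κ‖ ^ 2 := by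
    rw [Complex.sq_norm, Complex.normSq_apply]; nlinarith
  have hc : Real.cosh (κ.re * t) ≤ 2 := by
    have h0 : 0 ≤ κ.re * t := mul_nonneg hσ0 ht
    have := Literature.MathematicalPhysics.QuantumLattice.cosh_sub_one_le_sq_of_abs_le_one (s := κ.re * t) (abs_le.mpr ⟨by linarith, hσt⟩)
    have hx1 : (κ.re * t) ^ 2 ≤ 1 := by nlinarith
    linarith
  have hre : |((Complex.cosh (κ * t) - 1) / κ ^ 2).re| ≤ 3 / κ.im ^ 2 := by
    calc |((Complex.cosh (κ * t) - 1) / κ ^ 2).re| ≤ ‖(Complex.cosh (κ * t) - 1) / κ ^ 2‖ :=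
          Complex.abs_re_le_norm _
      _ = ‖Complex.cosh (κ * t) - 1‖ / ‖κ‖ ^ 2 := by rw [norm_div, norm_pow]
      _ ≤ (‖Complex.cosh (κ * t)‖ + 1) / ‖κ‖ ^ 2 := by
          gcongr
          exact (norm_sub_le _ _).trans (by simp)
      _ ≤ (Real.cosh (κ.re * t) + 1) / ‖κ‖ ^ 2 := by gcongr; exact norm_cosh_mul_le κ t
      _ ≤ 3 / ‖κ‖ ^ 2 := by gcongr; linarith
      _ ≤ 3 / κ.im ^ 2 := by gcongr
  unfold quadTerm
  rw [abs_mul, abs_mul, show |(4 : ℝ)| = 4 by norm_num]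
  calc 4 * |m| * |((Complex.cosh (κ * t) - 1) / κ ^ 2).re| ≤ 4 * |m| * (3 / κ.im ^ 2) := by gcongr
    _ = 12 * |m| / κ.im ^ 2 := by ring

/-- **ATOM LOWER BOUND for `quadTerm`.**  `quadTerm m κ t ≥ −20·m·σ*²·t²/γ²` for `m ≥ 0`, `0 ≤ σ ≤ σ* `,
`σ ≤ γ`, `0 < γ`, `0 ≤ t`, `σt ≤ 1`. -/
theorem quadTerm_ge {m σs : ℝ} {κ : ℂ} {t : ℝ} (hm : 0 ≤ m) (hσ0 : 0 ≤ κ.re) (hσs : κ.re ≤ σs)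
    (hσγ : κ.re ≤ κ.im) (hγ : 0 < κ.im) (ht : 0 ≤ t) (hσt : κ.re * t ≤ 1) :
    -(20 * m * σs ^ 2 * t ^ 2 / κ.im ^ 2) ≤ quadTerm m κ t := by
  have h := cosh_div_sq_re_ge hσ0 hσγ hγ ht hσt
  have hσ2 : κ.re ^ 2 ≤ σs ^ 2 := pow_le_pow_left₀ hσ0 hσs 2
  unfold quadTerm
  have : -(5 * σs ^ 2 * t ^ 2 / κ.im ^ 2) ≤ ((Complex.cosh (κ * t) - 1) / κ ^ 2).re := by
    refine le_trans ?_ h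
    rw [neg_le_neg_iff]
    gcongr
  have h4 := mul_le_mul_of_nonneg_left this (by positivity : (0 : ℝ) ≤ 4 * m)
  have e : 4 * m * -(5 * σs ^ 2 * t ^ 2 / κ.im ^ 2) = -(20 * m * σs ^ 2 * t ^ 2 / κ.im ^ 2) := by ring
  linarith

/-! ## 10. (G1) for a configuration: the tower trace dominates its unresolved count -/

open Summit.RiemannHypothesis.RiemannHypothesis.Theorems.Splittings.ScrewLatticeTower
open Summit.RiemannHypothesis.RiemannHypothesis.Theorems.Splittings.ScrewLatticeWolff (modelPsi)

/-- The standing (H0)-type hypotheses on a configuration used by the count theft law: non-negative weights,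
abscissae in `[0, σ*]` with `σ* ≤ 1/2`, ordinates `≥ 1`, and `A_Z = Σ (m₁/γ₁² + m₂/γ₂²) < ∞`. -/
structure GermHyp (σs : ℝ) (Z : Config) : Prop where
  /-- weights are non-negative -/
  m_nonneg : ∀ i, 0 ≤ Z.m₁ i ∧ 0 ≤ Z.m₂ i
  /-- abscissae in `[0, σ*]` -/
  re_mem : ∀ i, (0 ≤ (Z.κ₁ i).re ∧ (Z.κ₁ i).re ≤ σs) ∧ (0 ≤ (Z.κ₂ i).re ∧ (Z.κ₂ i).re ≤ σs)
  /-- `σ* ≤ 1/2` -/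
  σs_le : σs ≤ 1 / 2
  /-- ordinates `≥ 1` -/
  one_le_im : ∀ i, 1 ≤ (Z.κ₁ i).im ∧ 1 ≤ (Z.κ₂ i).im
  /-- `Σ m/γ² < ∞` -/
  summable : Summable fun i ↦ Z.m₁ i / (Z.κ₁ i).im ^ 2 + Z.m₂ i / (Z.κ₂ i).im ^ 2

/-- Under `GermHyp`, for `0 ≤ t ≤ 1` the atom family of `Z.psi t` is absolutely summable, dominated by
`12·(m₁/γ₁² + m₂/γ₂²)`. -/
theorem GermHyp.summable_terms {σs : ℝ} {Z : Config} (hZ : GermHyp σs Z) {t : ℝ} (ht0 : 0 ≤ t) (ht1 : t ≤ 1) :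
    Summable fun i ↦ quadTerm (Z.m₁ i) (Z.κ₁ i) t + quadTerm (Z.m₂ i) (Z.κ₂ i) t := by
  refine Summable.of_norm_bounded (hZ.summable.mul_left 12) fun i ↦ ?_
  have h1 := hZ.re_mem i
  have h2 := hZ.one_le_im i
  have hm := hZ.m_nonneg i
  have hσt₁ : (Z.κ₁ i).re * t ≤ 1 := by nlinarith [hZ.σs_le]
  have hσt₂ : (Z.κ₂ i).re * t ≤ 1 := by nlinarith [hZ.σs_le]
  have b1 := abs_quadTerm_le (m := Z.m₁ i) h1.1.1 (by linarith [h2.1]) ht0 hσt₁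
  have b2 := abs_quadTerm_le (m := Z.m₂ i) h1.2.1 (by linarith [h2.2]) ht0 hσt₂
  rw [abs_of_nonneg hm.1] at b1
  rw [abs_of_nonneg hm.2] at b2
  rw [Real.norm_eq_abs]
  calc |quadTerm (Z.m₁ i) (Z.κ₁ i) t + quadTerm (Z.m₂ i) (Z.κ₂ i) t|
      ≤ |quadTerm (Z.m₁ i) (Z.κ₁ i) t| + |quadTerm (Z.m₂ i) (Z.κ₂ i) t| := abs_add_le _ _
    _ ≤ 12 * Z.m₁ i / (Z.κ₁ i).im ^ 2 + 12 * Z.m₂ i / (Z.κ₂ i).im ^ 2 := add_le_add b1 b2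
    _ = 12 * (Z.m₁ i / (Z.κ₁ i).im ^ 2 + Z.m₂ i / (Z.κ₂ i).im ^ 2) := by ring

/-- **(G1) FOR A CONFIGURATION.**  Under `GermHyp σ* Z`, for `0 < t ≤ 1` and ANY finite set `s` of atoms of the
first family unresolved at time `t` (`‖κ₁ i‖·t ≤ 1`):
`(43/24)·t²·Σ_{i ∈ s} m₁ i − 20·σ*²·t²·A_Z ≤ Ψ_Z(t)`,  `A_Z = Σ' (m₁/γ₁² + m₂/γ₂²)`.
(Unresolved atoms in `s` at their germ `≥ (43/24)m t²`; every other atom at its uniform floor `−20 m σ*² t²/γ²`.) -/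
theorem Config.psi_ge_unresolved {σs : ℝ} {Z : Config} (hZ : GermHyp σs Z) {t : ℝ} (ht0 : 0 < t) (ht1 : t ≤ 1)
    (s : Finset Z.ι) (hs : ∀ i ∈ s, ‖Z.κ₁ i‖ * t ≤ 1) :
    43 / 24 * t ^ 2 * ∑ i ∈ s, Z.m₁ i
      - 20 * σs ^ 2 * t ^ 2 * ∑' i, (Z.m₁ i / (Z.κ₁ i).im ^ 2 + Z.m₂ i / (Z.κ₂ i).im ^ 2) ≤ Z.psi t := by
  classical
  have hsum := hZ.summable_terms ht0.le ht1
  -- the minorant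
  set g : Z.ι → ℝ := fun i ↦ (if i ∈ s then 43 / 24 * t ^ 2 * Z.m₁ i else 0)
      - 20 * σs ^ 2 * t ^ 2 * (Z.m₁ i / (Z.κ₁ i).im ^ 2 + Z.m₂ i / (Z.κ₂ i).im ^ 2) with hg
  have hg1 : Summable fun i ↦ (if i ∈ s then 43 / 24 * t ^ 2 * Z.m₁ i else 0 : ℝ) :=
    summable_of_ne_finset_zero (s := s) (fun i hi ↦ if_neg hi)
  have hg2 : Summable fun i ↦ 20 * σs ^ 2 * t ^ 2 * (Z.m₁ i / (Z.κ₁ i).im ^ 2 + Z.m₂ i / (Z.κ₂ i).im ^ 2) :=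
    hZ.summable.mul_left _
  have hgs : Summable g := hg1.sub hg2
  have hle : ∀ i, g i ≤ quadTerm (Z.m₁ i) (Z.κ₁ i) t + quadTerm (Z.m₂ i) (Z.κ₂ i) t := by
    intro i
    have h1 := hZ.re_mem i
    have h2 := hZ.one_le_im i
    have hm := hZ.m_nonneg i
    have hσs0 : 0 ≤ σs := le_trans h1.1.1 h1.1.2
    have hσt₁ : (Z.κ₁ i).re * t ≤ 1 := by nlinarith [hZ.σs_le]
    have hσt₂ : (Z.κ₂ i).re * t ≤ 1 := by nlinarith [hZ.σs_le]
    have hσγ₁ : (Z.κ₁ i).re ≤ (Z.κ₁ i).im := by linarith [hZ.σs_le, h1.1.2, h2.1]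
    have hσγ₂ : (Z.κ₂ i).re ≤ (Z.κ₂ i).im := by linarith [hZ.σs_le, h1.2.2, h2.2]
    have q2 := quadTerm_ge hm.2 h1.2.1 h1.2.2 hσγ₂ (by linarith [h2.2]) ht0.le hσt₂
    have q1 := quadTerm_ge hm.1 h1.1.1 h1.1.2 hσγ₁ (by linarith [h2.1]) ht0.le hσt₁
    have hfloor₁ : -(20 * σs ^ 2 * t ^ 2 * (Z.m₁ i / (Z.κ₁ i).im ^ 2)) ≤ quadTerm (Z.m₁ i) (Z.κ₁ i) t := by
      refine le_trans (le_of_eq ?_) q1; ring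
    have hfloor₂ : -(20 * σs ^ 2 * t ^ 2 * (Z.m₂ i / (Z.κ₂ i).im ^ 2)) ≤ quadTerm (Z.m₂ i) (Z.κ₂ i) t := by
      refine le_trans (le_of_eq ?_) q2; ring
    simp only [hg]
    split_ifs with hi
    · -- unresolved atom of the first family: germ lower bound
      have hκ : Z.κ₁ i ≠ 0 := fun h ↦ by have := h2.1; rw [h] at this; simp at this; linarith
      have hu := (quadTerm_germ_bounds hm.1 hκ (by rw [abs_of_pos ht0]; exact hs i hi)).1
      have hnn : 0 ≤ 20 * σs ^ 2 * t ^ 2 * (Z.m₁ i / (Z.κ₁ i).im ^ 2) := by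
        have := hm.1; positivity
      linarith
    · linarith
  have htsum_g : ∑' i, g i = 43 / 24 * t ^ 2 * ∑ i ∈ s, Z.m₁ i
      - 20 * σs ^ 2 * t ^ 2 * ∑' i, (Z.m₁ i / (Z.κ₁ i).im ^ 2 + Z.m₂ i / (Z.κ₂ i).im ^ 2) := by
    simp only [hg]
    rw [hg1.tsum_sub hg2, tsum_mul_left, tsum_eq_sum (s := s) (fun i hi ↦ if_neg hi), Finset.mul_sum]
    congr 1
    exact Finset.sum_congr rfl fun i hi ↦ if_pos hi
  rw [← htsum_g]
  exact hgs.tsum_le_tsum hle hsum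

end Summit.RiemannHypothesis.RiemannHypothesis.Theorems.Splittings.SlidingGerm
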